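import Literature.MathematicalPhysics.QuantumLattice.OrbitStateVariationalCertificate
import Literature.MathematicalPhysics.QuantumLattice.HubbardNNNHoppingTorusLimitCorrelator
import HarnessLib

/-!
# `t–t'` Hubbard model: VARIATIONAL window certificates (energy row, no stationarity) bound the
# expectations of every low-energy torus vector and of every torus limit of such vectors

Family `hubbard` (topic `MathematicalPhysics/QuantumLattice`). Companion of
`HubbardNNNHoppingCorrelatorWindowCertificate.lean` / `HubbardNNNHoppingTorusLimitCorrelator.lean`
(window certificates read in sector EIGENVECTORS and their torus limits). Here the vector is
ARBITRARY: a unit `ζ` of the torus Fock space, not an eigenvector, in no particle-number sector —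
the class met by the number-indefinite symmetry-breaking trial states of Horsch–von der Linden /
Kaplan–Horsch–von der Linden (Koma–Tasaki 1994 §2.2), e.g. the one-point witness `(ψ + Oψ/‖Oψ‖)/√2`
of a sector ground state `ψ`. Accordingly the certificate identity carries NO stationarity terms
`[H_{Λ'}, B]` and NO charged-word terms; it keeps SOS, affine-`D₄` symmetry defects, anti-Hermitian
parts, residual words, the two filling rows and the energy row (Wang et al. 2024 §III: the
variational / energy-window tier of the reduced-density-matrix bootstrap).

* `hubbardTorusTT'_re_orbitState_ge_of_variational_certificate_ineq` — torus level: a local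
  certificate read in the space-group orbit state `ω̄_ζ` of any unit `ζ`:
  `c − Σ‖aₖ‖ + Σᵢ μᵢ (Re⟨ζ, Gᵢ ζ⟩/L² − νᵢ) + κ (u − Re⟨ζ, H ζ⟩/L²) ≤ Re ω̄_ζ(X)` (filling operators
  `Gᵢ` commuting with the space group; no sign condition on `κ`).
* `re_orbitState_ge_of_window_variational_certificate_d4_TT'_ineq` — window level: ONE identity in
  `𝔄_{Λ'}` proves, for every `L ≥ 3` fitting the window and every unit `ζ`,
  `c − Σ‖aₖ‖ + Σ_σ μ_σ (Re⟨ζ, N_σ ζ⟩/L² − ν) + κ (u − Re⟨ζ, H^{tt'}_L ζ⟩/L²) ≤ Re ω̄_ζ(Γ(ι_{Λ',L}) X)`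
  (`N_σ = Σ_y n_{yσ}`).
* `InfVolFermionState.IsTorusLimitOf.re_sum_expect_d4_ge_of_window_variational_certificate_TT'` —
  thermodynamic limit: for unit vectors `ζ_L` along `Ls → ∞` with energy densities
  `Re⟨ζ_L, H^{tt'}_L ζ_L⟩/L² → e ≤ u` and spin fillings `Re⟨ζ_L, N_σ ζ_L⟩/L² → n/2`, every torus limit
  `ω` obeys `c − Σ‖aₖ‖ + (Σ_σ μ_σ)(n/2 − ν) ≤ |S|⁻¹ Σ_{γ∈S} Re ω_{γΛ'}(Γ(d4Emb γ 0) X)` (`κ ≥ 0`).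

References: J. Wang et al., PRX 14 (2024) 031006, §III [WangEtAl2024]; X. Han, arXiv:2006.06002, §3
[Han2020Bootstrap]; T. Koma, H. Tasaki, J. Stat. Phys. 76 (1994) 745, §2.2 [KomaTasaki1994].
-/

noncomputable section

namespace Literature.MathematicalPhysics.QuantumLattice

open Matrix Finset HubbardWave0 Literature.Probability.LatticeModels
open Literature.MathematicalPhysics.QuantumManyBody.StateRelaxation
open _root_.Filter
open scoped ComplexOrder BigOperators _root_.Topology

/-! ### The space group commutes with the spin-resolved particle numbers -/

section SpinNumber

variable {L : ℕ} [NeZero L]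

/-- A site-permutation unitary `U_π` commutes with the spin-resolved particle number
`N_σ = Σ_y n_{yσ}` (`= ½ N ± S^z`; lattice symmetries commute with `N` and `S^z`).
[cite: Tasaki2020, §9.3.1] -/
theorem fockRelabel_mapEquiv_commute_spinNumber {Λ : Type*} [LinearOrder Λ] [Fintype Λ]
    (g : Equiv.Perm Λ) (σ : Fin 2) :
    Commute (fockRelabel (Orb.mapEquiv g)).val
      (∑ y : Λ, numberOp y σ : Matrix (Finset (Orb Λ)) (Finset (Orb Λ)) ℂ) := by
  rw [sum_numberOp_eq_half_totalNumber_add_spinZ]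
  exact ((fockRelabel_mapEquiv_commute_totalNumber g).smul_right _).add_right
    ((fockRelabel_mapEquiv_commute_spinZ g).smul_right _)

/-- The space-group unitaries `U_w D_γ` (translations and point group of the square torus) commute
with `N_σ = Σ_y n_{yσ}`. [cite: Tasaki2020, §9.3.1] -/
theorem spaceGroupUnitary_commute_spinNumber (S : Finset (DihedralGroup 4)) (g : TorusSite 2 L × ↥S)
    (σ : Fin 2) :
    spaceGroupUnitary S g * (∑ y : FermionTorus 2 L, numberOp y σ) =
      (∑ y : FermionTorus 2 L, numberOp y σ) * spaceGroupUnitary S g := by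
  have hT : Commute (fockTranslate (L := L) g.1).val
      (∑ y : FermionTorus 2 L, numberOp y σ : Matrix (Finset (Orb (FermionTorus 2 L))) _ ℂ) :=
    fockRelabel_mapEquiv_commute_spinNumber _ σ
  have hD : Commute (fockD4 (L := L) (g.2 : DihedralGroup 4)).val
      (∑ y : FermionTorus 2 L, numberOp y σ : Matrix (Finset (Orb (FermionTorus 2 L))) _ ℂ) := by
    rw [fockD4_apply, Orb.d4Perm_eq_mapEquiv]
    exact fockRelabel_mapEquiv_commute_spinNumber _ σ
  show (fockTranslate g.1).val * (fockD4 (L := L) (g.2 : DihedralGroup 4)).val * _ = _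
  rw [Matrix.mul_assoc, hD.eq, ← Matrix.mul_assoc, hT.eq, Matrix.mul_assoc]
  rfl

end SpinNumber

/-! ### Torus level -/

section Torus

variable {L : ℕ} [NeZero L]

/-- (Local to this section, as in `HubbardNNNHoppingCorrelatorCertificate`.) [folklore] -/
local instance (priority := high) instDecidableEqFermionTorusVarTT' : DecidableEq (FermionTorus 2 L) :=
  LinearOrder.toDecidableEq

/-- **Variational certificate ⇒ space-group-averaged expectation of a local observable in EVERY unit
vector of the `t–t'` torus.** Let `H = hubbardTorusTT' L t t' U`, `ζ` a unit vector lying in a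
subspace `K` stable under the adjoints of the space-group unitaries `(U_w D_γ)_{w, γ∈S}` (`S ∋ 1`
closed under multiplication; `K = ⊤` is allowed), `ω̄_ζ` the orbit state. Suppose the translates of a
local energy `E_loc` sum to `H`, those of observables `Dᵢ` to operators `Gᵢ` commuting with the space
group, and the torus algebra carries the identity
`X − c·1 − Σᵢ μᵢ (Dᵢ − νᵢ·1) − κ (u·1 − E_loc) = Σ Λₐᵦ Oₐᴴ O_b + (Σₗ (U_{wₗ} D_{γₗ} Yₗ (U_{wₗ} D_{γₗ})ᴴ − Yₗ)
  + Σᵣ (Zᵣ (Qᵣ − qᵣ) + (Qᵣ − qᵣ) Z'ᵣ) + Σⱼ (Cⱼ Wⱼ − Wⱼ Cⱼ)) + (Σₘ dₘ (Vₘᴴ − Vₘ) + Σₖ aₖ Mₖ)`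
with `Λ ⪰ 0`, `γₗ ∈ S`, Hermitian `Qᵣ = qᵣ`, `Cⱼ = q'ⱼ` on `K`, real `dₘ`, contractions `Mₖ` — and NO
`[H, ·]` terms. Then `c − Σₖ ‖aₖ‖ + Σᵢ μᵢ (Re⟨ζ,Gᵢζ⟩/L² − νᵢ) + κ (u − Re⟨ζ,Hζ⟩/L²) ≤ Re ω̄_ζ(X)`.
Wang et al. 2024 §III (energy rows), Han 2020 §3 (symmetry rows), for an arbitrary vector.
[cite: WangEtAl2024, §III] -/
theorem hubbardTorusTT'_re_orbitState_ge_of_variational_certificate_ineq (t t' U : ℝ)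
    {S : Finset (DihedralGroup 4)} (h1 : (1 : DihedralGroup 4) ∈ S) (hmul : ∀ a ∈ S, ∀ b ∈ S, a * b ∈ S)
    (K : Submodule ℂ (Fock (Orb (FermionTorus 2 L))))
    (hK : ∀ g : TorusSite 2 L × ↥S, ∀ φ ∈ K, (spaceGroupUnitary S g)ᴴ *ᵥ φ ∈ K)
    {ζ : Fock (Orb (FermionTorus 2 L))} (hζK : ζ ∈ K) (hζ1 : star ζ ⬝ᵥ ζ = 1)
    (X Eloc : Matrix (Finset (Orb (FermionTorus 2 L))) (Finset (Orb (FermionTorus 2 L))) ℂ)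
    (hE : ∑ v : TorusSite 2 L, (fockTranslate v).val * Eloc * (fockTranslate v).valᴴ =
      hubbardTorusTT' L t t' U) (κ u : ℝ)
    {δ' : Type*} (dens : Finset δ') (μ ν : δ' → ℝ)
    (D G : δ' → Matrix (Finset (Orb (FermionTorus 2 L))) (Finset (Orb (FermionTorus 2 L))) ℂ)
    (hD : ∀ i ∈ dens, ∑ v : TorusSite 2 L, (fockTranslate v).val * D i * (fockTranslate v).valᴴ = G i)
    (hG : ∀ i ∈ dens, ∀ g : TorusSite 2 L × ↥S, spaceGroupUnitary S g * G i = G i * spaceGroupUnitary S g)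
    {m : Type*} [Fintype m] [DecidableEq m] {Λm : Matrix m m ℂ} (hΛ : Λm.PosSemidef)
    (O : m → Matrix (Finset (Orb (FermionTorus 2 L))) (Finset (Orb (FermionTorus 2 L))) ℂ)
    {ι : Type*} (tt : Finset ι) (γ : ι → DihedralGroup 4) (hγS : ∀ l ∈ tt, γ l ∈ S)
    (wv : ι → TorusSite 2 L)
    (Y : ι → Matrix (Finset (Orb (FermionTorus 2 L))) (Finset (Orb (FermionTorus 2 L))) ℂ)
    {ρ : Type*} (r : Finset ρ)
    (Q Z Z' : ρ → Matrix (Finset (Orb (FermionTorus 2 L))) (Finset (Orb (FermionTorus 2 L))) ℂ)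
    (q : ρ → ℝ) (hQh : ∀ i ∈ r, (Q i).IsHermitian)
    (hQ : ∀ i ∈ r, ∀ φ ∈ K, Q i *ᵥ φ = ((q i : ℝ) : ℂ) • φ)
    {γ' : Type*} (u' : Finset γ')
    (C W : γ' → Matrix (Finset (Orb (FermionTorus 2 L))) (Finset (Orb (FermionTorus 2 L))) ℂ)
    (qc : γ' → ℝ) (hCh : ∀ j ∈ u', (C j).IsHermitian)
    (hC : ∀ j ∈ u', ∀ φ ∈ K, C j *ᵥ φ = ((qc j : ℝ) : ℂ) • φ)
    {δ : Type*} (ah : Finset δ) (dc : δ → ℝ)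
    (V : δ → Matrix (Finset (Orb (FermionTorus 2 L))) (Finset (Orb (FermionTorus 2 L))) ℂ)
    {κ'' : Type*} (w : Finset κ'') (a : κ'' → ℂ)
    (M : κ'' → Matrix (Finset (Orb (FermionTorus 2 L))) (Finset (Orb (FermionTorus 2 L))) ℂ)
    (hM : ∀ k ∈ w, (M k).IsContraction) {c : ℝ}
    (hcert : X - (c : ℂ) • (1 : Matrix (Finset (Orb (FermionTorus 2 L))) (Finset (Orb (FermionTorus 2 L))) ℂ) -
        ∑ i ∈ dens, ((μ i : ℝ) : ℂ) • (D i - ((ν i : ℝ) : ℂ) •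
          (1 : Matrix (Finset (Orb (FermionTorus 2 L))) (Finset (Orb (FermionTorus 2 L))) ℂ)) -
        ((κ : ℝ) : ℂ) • (((u : ℝ) : ℂ) •
          (1 : Matrix (Finset (Orb (FermionTorus 2 L))) (Finset (Orb (FermionTorus 2 L))) ℂ) - Eloc) =
      gramForm Λm O +
        (∑ l ∈ tt, ((fockTranslate (wv l)).val * (fockD4 (L := L) (γ l)).val * Y l *
              ((fockTranslate (wv l)).val * (fockD4 (L := L) (γ l)).val)ᴴ - Y l) +
          ∑ i ∈ r, (Z i * (Q i - ((q i : ℝ) : ℂ) • 1) + (Q i - ((q i : ℝ) : ℂ) • 1) * Z' i) +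
          ∑ j ∈ u', (C j * W j - W j * C j)) +
        (∑ m' ∈ ah, ((dc m' : ℝ) : ℂ) • ((V m')ᴴ - V m') + ∑ k ∈ w, a k • M k)) :
    c - ∑ k ∈ w, ‖a k‖ +
        ∑ i ∈ dens, μ i * ((star ζ ⬝ᵥ (G i *ᵥ ζ)).re / (L : ℝ) ^ 2 - ν i) +
        κ * (u - (star ζ ⬝ᵥ (hubbardTorusTT' L t t' U *ᵥ ζ)).re / (L : ℝ) ^ 2) ≤
      (orbitState (spaceGroupUnitary S) ζ X).re := by
  haveI : Nonempty ↥S := ⟨⟨1, h1⟩⟩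
  have h := re_orbitState_ge_of_variational_certificate_ineq (hubbardTorusTT' L t t' U) K hζK hζ1
    (spaceGroupUnitary S) (fun g' => spaceGroupUnitary_mul_hubbardTorusTT' S t t' U g')
    (fun g' => d4Affine_conjTranspose_mul_self _ _) hK
    (fun v => (fockTranslate v).val) (fun v => spaceGroupUnitary_closed_translate h1 hmul v)
    X Eloc hE κ u dens μ ν D G hD hG hΛ O tt
    (fun l => (fockTranslate (wv l)).val * (fockD4 (L := L) (γ l)).val) Y
    (fun l hl => spaceGroupUnitary_closed hmul (wv l) (hγS l hl))
    r Q Z Z' q hQh hQ u' C W qc hCh hC ah dc V w a M hM hcert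
  rw [card_torusSite] at h
  push_cast at h
  exact h

end Torus

/-! ### Window level -/

section Window

variable {L : ℕ} [NeZero L]

/-- (Local to this section.) [folklore] -/
local instance (priority := high) instDecidableEqFermionTorusVarWinTT : DecidableEq (FermionTorus 2 L) :=
  LinearOrder.toDecidableEq

/-- **Variational window certificate ⇒ space-group-averaged expectation of a local observable in EVERY
unit vector of every large `t–t'` torus.** Data as in `re_orbitState_ge_of_window_certificate_d4_TT'_ineq`
WITHOUT the stationarity family `[H^{tt'}_{Λ'}, Bₖ]` and WITHOUT charged words: the identity in `𝔄_{Λ'}`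
`X − c·1 − Σ_σ μ_σ (n_{0σ} − ν·1) − κ (u·1 − Γ(incl) E^{tt'}_Φ) = Σ Λₐᵦ Oₐᴴ O_b
  + Σₗ (Γ(incl)(Γ(d4Emb γₗ wₗ) Yₗ) − Γ(incl) Yₗ) + (Σₘ dₘ • (Vₘᴴ − Vₘ) + Σₖ aₖ • vₖ)`.
Then for every `L ≥ 3` with `x ↦ x mod L` injective on `Λ'`, every finite `S ∋ 1` closed
under multiplication with `γₗ ∈ S`, and EVERY unit vector `ζ`:
`c − Σₖ ‖aₖ‖ + Σ_σ μ_σ (Re⟨ζ, N_σ ζ⟩/L² − ν) + κ (u − Re⟨ζ, H^{tt'}_L ζ⟩/L²) ≤ Re ω̄_ζ(Γ(ι_{Λ',L}) X)`,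
`N_σ = Σ_y n_{yσ}`, `ω̄_ζ = orbitState (spaceGroupUnitary S) ζ`. Wang et al. 2024 §III in Han's
translation-invariant form, read in the symmetrised state of an arbitrary vector.
[cite: WangEtAl2024, §III] [cite: Han2020Bootstrap, §3] -/
theorem re_orbitState_ge_of_window_variational_certificate_d4_TT'_ineq (t t' U : ℝ) (hL : 3 ≤ L)
    {Λ Λ' : Finset (Site 2)} (hΛ : Λ ⊆ Λ')
    (h0 : thicken ({0} : Finset (Site 2)) 1 ⊆ Λ') (hz : (0 : Site 2) ∈ Λ')
    (hInj' : Set.InjOn (Torus.proj (d := 2) L) ↑Λ')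
    {S : Finset (DihedralGroup 4)} (h1 : (1 : DihedralGroup 4) ∈ S) (hmul : ∀ a ∈ S, ∀ b ∈ S, a * b ∈ S)
    {ζ : Fock (Orb (FermionTorus 2 L))} (hζ1 : star ζ ⬝ᵥ ζ = 1)
    (Xw : FermionOp Λ') (κ u : ℝ) (μ : Fin 2 → ℝ) (ν : ℝ)
    {m : Type*} [Fintype m] [DecidableEq m] {Λm : Matrix m m ℂ} (hΛm : Λm.PosSemidef)
    (O : m → FermionOp Λ')
    {ι : Type*} (tt : Finset ι) (γ : ι → DihedralGroup 4) (hγS : ∀ l ∈ tt, γ l ∈ S) (wv : ι → Site 2)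
    (hsh : ∀ l, d4ShiftSet (γ l) (wv l) Λ ⊆ Λ') (Y : ι → FermionOp Λ)
    {δ : Type*} (ah : Finset δ) (dc : δ → ℝ) (V : δ → FermionOp Λ')
    {κ'' : Type*} (w : Finset κ'') (a : κ'' → ℂ) (word : κ'' → List (Orb (PolySite Λ') × Bool)) {c : ℝ}
    (hcert : Xw - (c : ℂ) • (1 : FermionOp Λ') -
        ∑ σ : Fin 2, ((μ σ : ℝ) : ℂ) • (nAt 0 hz σ - ((ν : ℝ) : ℂ) • (1 : FermionOp Λ')) -
        ((κ : ℝ) : ℂ) • (((u : ℝ) : ℂ) • (1 : FermionOp Λ') -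
          fermionEmbed (PolySite.incl h0) ((hubbardTTPrimeFermionInteraction t t' U).meanEnergyObs 1)) =
      gramForm Λm O +
        ∑ l ∈ tt, (fermionEmbed (PolySite.incl (hsh l)) (fermionEmbed (PolySite.d4Emb (γ l) (wv l) Λ) (Y l)) -
            fermionEmbed (PolySite.incl hΛ) (Y l)) +
        (∑ m' ∈ ah, ((dc m' : ℝ) : ℂ) • ((V m')ᴴ - V m') + ∑ k ∈ w, a k • ladderWord (word k))) :
    c - ∑ k ∈ w, ‖a k‖ +
        ∑ σ : Fin 2, μ σ * ((star ζ ⬝ᵥ ((∑ y : FermionTorus 2 L, numberOp y σ) *ᵥ ζ)).re / (L : ℝ) ^ 2 - ν) +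
        κ * (u - (star ζ ⬝ᵥ (hubbardTorusTT' L t t' U *ᵥ ζ)).re / (L : ℝ) ^ 2) ≤
      (orbitState (spaceGroupUnitary S) ζ (fermionEmbed (PolySite.toTorusEmb L hInj') Xw)).re := by
  have hInjΛ : Set.InjOn (Torus.proj (d := 2) L) ↑Λ := hInj'.mono (by exact_mod_cast hΛ)
  have hInj0 : Set.InjOn (Torus.proj (d := 2) L) ↑(thicken ({0} : Finset (Site 2)) 1) :=
    hInj'.mono (by exact_mod_cast h0)
  set Γ' := fermionEmbed (PolySite.toTorusEmb L hInj') with hΓ'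
  set ΓΛ := fermionEmbed (PolySite.toTorusEmb L hInjΛ) with hΓΛ
  set H := hubbardTorusTT' L t t' U with hH
  set EΦ := (hubbardTTPrimeFermionInteraction t t' U).meanEnergyObs 1 with hEΦ
  -- the local energy `Γ(ι₀) E_Φ`, whose translates sum to `H`
  set X := Γ' (fermionEmbed (PolySite.incl h0) EΦ) with hX
  have hX0 : X = fermionEmbed (PolySite.toTorusEmb L hInj0) EΦ := fermionEmbed_toTorusEmb_incl h0 hInj' EΦ
  have hsum : ∑ v' : TorusSite 2 L, (fockTranslate v').val * X * (fockTranslate v').valᴴ = H := by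
    rw [hX0]
    have h := sum_relabel_translate_hubbardTTPrime_meanEnergyObs (L := L) t' t U hL
    simp_rw [relabel_eq_fockRelabel_conj] at h
    exact h
  -- density observables
  set D : Fin 2 → Matrix (Finset (Orb (FermionTorus 2 L))) (Finset (Orb (FermionTorus 2 L))) ℂ :=
    fun σ => numberOp (FermionTorus.ofTorusSite (0 : TorusSite 2 L)) σ with hD
  set G : Fin 2 → Matrix (Finset (Orb (FermionTorus 2 L))) (Finset (Orb (FermionTorus 2 L))) ℂ :=
    fun σ => ∑ y : FermionTorus 2 L, numberOp y σ with hG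
  have hDΓ : ∀ σ, Γ' (nAt 0 hz σ) = D σ := fun σ => fermionEmbed_toTorusEmb_nAt_zero hz hInj' σ
  have hDsum : ∀ σ ∈ (Finset.univ : Finset (Fin 2)),
      ∑ v' : TorusSite 2 L, (fockTranslate v').val * D σ * (fockTranslate v').valᴴ = G σ :=
    fun σ _ => sum_conj_fockTranslate_numberOp 0 σ
  have hGT : ∀ σ ∈ (Finset.univ : Finset (Fin 2)), ∀ g : TorusSite 2 L × ↥S,
      spaceGroupUnitary S g * G σ = G σ * spaceGroupUnitary S g :=
    fun σ _ g => spaceGroupUnitary_commute_spinNumber S g σ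
  -- symmetry family: affine `D₄` maps, as torus matrices
  set Yt : ι → Matrix (Finset (Orb (FermionTorus 2 L))) (Finset (Orb (FermionTorus 2 L))) ℂ :=
    fun l => ΓΛ (Y l) with hYt
  -- residual words
  set emb : Orb (PolySite Λ') × Bool → Orb (FermionTorus 2 L) × Bool :=
    fun p => (Orb.embMap (PolySite.toTorusEmb L hInj') p.1, p.2) with hemb
  set M : κ'' → Matrix (Finset (Orb (FermionTorus 2 L))) (Finset (Orb (FermionTorus 2 L))) ℂ :=
    fun k => ladderWord ((word k).map emb) with hM
  have hMc : ∀ k ∈ w, (M k).IsContraction := fun k _ => by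
    rw [hM]; dsimp only; rw [ladderWord_eq_prod]; exact isContraction_prod_ladder _
  -- the left-hand side, pulled back into the torus
  have hlhs : Γ' (Xw - (c : ℂ) • (1 : FermionOp Λ') -
        ∑ σ : Fin 2, ((μ σ : ℝ) : ℂ) • (nAt 0 hz σ - ((ν : ℝ) : ℂ) • (1 : FermionOp Λ')) -
        ((κ : ℝ) : ℂ) • (((u : ℝ) : ℂ) • (1 : FermionOp Λ') - fermionEmbed (PolySite.incl h0) EΦ)) =
      Γ' Xw - (c : ℂ) • (1 : Matrix (Finset (Orb (FermionTorus 2 L))) (Finset (Orb (FermionTorus 2 L))) ℂ) -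
        ∑ σ ∈ (Finset.univ : Finset (Fin 2)), ((μ σ : ℝ) : ℂ) • (D σ - ((ν : ℝ) : ℂ) •
          (1 : Matrix (Finset (Orb (FermionTorus 2 L))) (Finset (Orb (FermionTorus 2 L))) ℂ)) -
        ((κ : ℝ) : ℂ) • (((u : ℝ) : ℂ) •
          (1 : Matrix (Finset (Orb (FermionTorus 2 L))) (Finset (Orb (FermionTorus 2 L))) ℂ) - X) := by
    have hs : Γ' (∑ σ : Fin 2, ((μ σ : ℝ) : ℂ) • (nAt 0 hz σ - ((ν : ℝ) : ℂ) • (1 : FermionOp Λ'))) =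
        ∑ σ ∈ (Finset.univ : Finset (Fin 2)), ((μ σ : ℝ) : ℂ) • (D σ - ((ν : ℝ) : ℂ) •
          (1 : Matrix (Finset (Orb (FermionTorus 2 L))) (Finset (Orb (FermionTorus 2 L))) ℂ)) := by
      rw [map_sum]
      exact Finset.sum_congr rfl fun σ _ => by rw [map_smul, map_sub, map_smul, map_one, hDΓ]
    have hk : Γ' (((κ : ℝ) : ℂ) • (((u : ℝ) : ℂ) • (1 : FermionOp Λ') - fermionEmbed (PolySite.incl h0) EΦ)) =
        ((κ : ℝ) : ℂ) • (((u : ℝ) : ℂ) •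
          (1 : Matrix (Finset (Orb (FermionTorus 2 L))) (Finset (Orb (FermionTorus 2 L))) ℂ) - X) := by
      rw [map_smul, map_sub, map_smul, map_one, hX]
    rw [map_sub, hk, map_sub, hs, map_sub, map_smul, map_one]
  -- the identity, pulled back into the torus (empty sector and charge families)
  have htorus : Γ' Xw - (c : ℂ) • (1 : Matrix (Finset (Orb (FermionTorus 2 L))) (Finset (Orb (FermionTorus 2 L))) ℂ) -
      ∑ σ ∈ (Finset.univ : Finset (Fin 2)), ((μ σ : ℝ) : ℂ) • (D σ - ((ν : ℝ) : ℂ) •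
        (1 : Matrix (Finset (Orb (FermionTorus 2 L))) (Finset (Orb (FermionTorus 2 L))) ℂ)) -
      ((κ : ℝ) : ℂ) • (((u : ℝ) : ℂ) •
        (1 : Matrix (Finset (Orb (FermionTorus 2 L))) (Finset (Orb (FermionTorus 2 L))) ℂ) - X) =
      gramForm Λm (fun i => Γ' (O i)) +
        (∑ l ∈ tt, ((fockTranslate (Torus.proj L (wv l))).val * (fockD4 (L := L) (γ l)).val * Yt l *
              ((fockTranslate (Torus.proj L (wv l))).val * (fockD4 (L := L) (γ l)).val)ᴴ - Yt l) +
          ∑ i ∈ (∅ : Finset (Fin 0)), ((0 : Matrix _ _ ℂ) * ((0 : Matrix _ _ ℂ) - (((0 : ℝ) : ℝ) : ℂ) • 1) +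
            ((0 : Matrix _ _ ℂ) - (((0 : ℝ) : ℝ) : ℂ) • 1) * (0 : Matrix _ _ ℂ)) +
          ∑ j ∈ (∅ : Finset (Fin 0)), ((0 : Matrix _ _ ℂ) * (0 : Matrix _ _ ℂ) - (0 : Matrix _ _ ℂ) * (0 : Matrix _ _ ℂ))) +
        (∑ m' ∈ ah, ((dc m' : ℝ) : ℂ) • ((Γ' (V m'))ᴴ - Γ' (V m')) + ∑ k ∈ w, a k • M k) := by
    have key := congrArg Γ' hcert
    rw [hlhs] at key
    have h2 : Γ' (∑ l ∈ tt, (fermionEmbed (PolySite.incl (hsh l)) (fermionEmbed (PolySite.d4Emb (γ l) (wv l) Λ) (Y l)) -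
        fermionEmbed (PolySite.incl hΛ) (Y l))) =
        ∑ l ∈ tt, ((fockTranslate (Torus.proj L (wv l))).val * (fockD4 (L := L) (γ l)).val * Yt l *
          ((fockTranslate (Torus.proj L (wv l))).val * (fockD4 (L := L) (γ l)).val)ᴴ - Yt l) := by
      rw [map_sum]
      refine Finset.sum_congr rfl fun l _ => ?_
      rw [hYt, hΓΛ, hΓ']
      exact fermionEmbed_toTorusEmb_d4_sub hΛ (γ l) (wv l) (hsh l) hInj' (Y l)
    have h4 : Γ' (∑ m' ∈ ah, ((dc m' : ℝ) : ℂ) • ((V m')ᴴ - V m')) =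
        ∑ m' ∈ ah, ((dc m' : ℝ) : ℂ) • ((Γ' (V m'))ᴴ - Γ' (V m')) := by
      rw [map_sum]
      refine Finset.sum_congr rfl fun m' _ => ?_
      rw [map_smul, map_sub, hΓ', fermionEmbed_conjTranspose]
    have h5 : Γ' (∑ k ∈ w, a k • ladderWord (word k)) = ∑ k ∈ w, a k • M k := by
      rw [map_sum]
      refine Finset.sum_congr rfl fun k _ => ?_
      rw [map_smul, hM, hΓ', fermionEmbed_ladderWord]
    rw [key, map_add, map_add, map_add, hΓ', fermionEmbed_gramForm, ← hΓ', h2, h4, h5,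
      Finset.sum_empty, Finset.sum_empty, add_zero, add_zero]
  have hmain := hubbardTorusTT'_re_orbitState_ge_of_variational_certificate_ineq t t' U h1 hmul ⊤
    (fun _ _ _ => Submodule.mem_top) (Submodule.mem_top : ζ ∈ (⊤ : Submodule ℂ _)) hζ1
    (Γ' Xw) X hsum κ u (Finset.univ : Finset (Fin 2)) μ (fun _ => ν) D G hDsum hGT hΛm
    (fun i => Γ' (O i)) tt γ hγS (fun l => Torus.proj L (wv l)) Yt
    (∅ : Finset (Fin 0)) (fun _ => 0) (fun _ => 0) (fun _ => 0) (fun _ => 0)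
    (fun i hi => absurd hi (Finset.notMem_empty i)) (fun i hi => absurd hi (Finset.notMem_empty i))
    (∅ : Finset (Fin 0)) (fun _ => 0) (fun _ => 0) (fun _ => 0)
    (fun i hi => absurd hi (Finset.notMem_empty i)) (fun i hi => absurd hi (Finset.notMem_empty i))
    ah dc (fun m' => Γ' (V m')) w a M hMc htorus
  exact hmain

end Window

/-! ### The thermodynamic limit -/

section Limit

/-- **Variational window certificate ⇒ bound for every torus limit of LOW-ENERGY unit vectors of the
`t–t'` Hubbard model on `ℤ²`.** Data: the identity of
`re_orbitState_ge_of_window_variational_certificate_d4_TT'_ineq` (no stationarity, no charged words),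
`κ ≥ 0`. Let `ζ_L` be unit vectors of the torus Fock spaces along `Ls → ∞` whose energy densities
`Re⟨ζ_L, H^{tt'}_L ζ_L⟩/L²` tend to `e ≤ u` and whose spin fillings `Re⟨ζ_L, N_σ ζ_L⟩/L²` tend to `n/2`
(`σ = ↑, ↓`), and `ω` a torus limit of `ζ` along `Ls`. Then
`c − Σₖ ‖aₖ‖ + (Σ_σ μ_σ)(n/2 − ν) ≤ |S|⁻¹ Σ_{γ∈S} Re ω_{γΛ'}(Γ(d4Emb γ 0) X)` — the variational /
energy-window tier read on the class of torus limits of number-indefinite low-energy states (the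
class of the Horsch–von der Linden / KHvdL one-point witnesses, Koma–Tasaki 1994 §2.2).
[cite: WangEtAl2024, §III] [cite: KomaTasaki1994, §2.2] -/
theorem InfVolFermionState.IsTorusLimitOf.re_sum_expect_d4_ge_of_window_variational_certificate_TT'
    (t t' U : ℝ) {n e : ℝ} {κ u : ℝ} (hκ : 0 ≤ κ) (hu : e ≤ u)
    {Λ Λ' : Finset (Site 2)} (hΛ : Λ ⊆ Λ')
    (h0 : thicken ({0} : Finset (Site 2)) 1 ⊆ Λ') (hz : (0 : Site 2) ∈ Λ')
    {S : Finset (DihedralGroup 4)} (h1 : (1 : DihedralGroup 4) ∈ S) (hmul : ∀ a ∈ S, ∀ b ∈ S, a * b ∈ S)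
    (Xw : FermionOp Λ') (μ : Fin 2 → ℝ) (ν : ℝ)
    {m : Type*} [Fintype m] [DecidableEq m] {Λm : Matrix m m ℂ} (hΛm : Λm.PosSemidef)
    (O : m → FermionOp Λ')
    {ι : Type*} (tt : Finset ι) (γ : ι → DihedralGroup 4) (hγS : ∀ l ∈ tt, γ l ∈ S) (wv : ι → Site 2)
    (hsh : ∀ l, d4ShiftSet (γ l) (wv l) Λ ⊆ Λ') (Y : ι → FermionOp Λ)
    {δ : Type*} (ah : Finset δ) (dc : δ → ℝ) (V : δ → FermionOp Λ')
    {κ'' : Type*} (w : Finset κ'') (a : κ'' → ℂ) (word : κ'' → List (Orb (PolySite Λ') × Bool)) {c : ℝ}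
    (hcert : Xw - (c : ℂ) • (1 : FermionOp Λ') -
        ∑ σ : Fin 2, ((μ σ : ℝ) : ℂ) • (nAt 0 hz σ - ((ν : ℝ) : ℂ) • (1 : FermionOp Λ')) -
        ((κ : ℝ) : ℂ) • (((u : ℝ) : ℂ) • (1 : FermionOp Λ') -
          fermionEmbed (PolySite.incl h0) ((hubbardTTPrimeFermionInteraction t t' U).meanEnergyObs 1)) =
      gramForm Λm O +
        ∑ l ∈ tt, (fermionEmbed (PolySite.incl (hsh l)) (fermionEmbed (PolySite.d4Emb (γ l) (wv l) Λ) (Y l)) -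
            fermionEmbed (PolySite.incl hΛ) (Y l)) +
        (∑ m' ∈ ah, ((dc m' : ℝ) : ℂ) • ((V m')ᴴ - V m') + ∑ k ∈ w, a k • ladderWord (word k)))
    {Ls : ℕ → ℕ} (hLs : Tendsto Ls atTop atTop)
    {ζ : ∀ L, Fock (Orb (FermionTorus 2 L))}
    (hζ1 : ∀ j, star (ζ (Ls j)) ⬝ᵥ ζ (Ls j) = 1)
    (hE : Tendsto (fun j => (star (ζ (Ls j)) ⬝ᵥ (hubbardTorusTT' (Ls j) t t' U *ᵥ ζ (Ls j))).re /
      ((Ls j : ℕ) : ℝ) ^ 2) atTop (𝓝 e))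
    (hN : ∀ σ : Fin 2, Tendsto (fun j => (star (ζ (Ls j)) ⬝ᵥ
      ((∑ y : FermionTorus 2 (Ls j), numberOp y σ) *ᵥ ζ (Ls j))).re / ((Ls j : ℕ) : ℝ) ^ 2) atTop (𝓝 (n / 2)))
    {ω : InfVolFermionState 2} (hω : ω.IsTorusLimitOf ζ Ls) :
    c - ∑ k ∈ w, ‖a k‖ + (∑ σ : Fin 2, μ σ) * (n / 2 - ν) ≤
      (S.card : ℝ)⁻¹ * ∑ g ∈ S,
        (ω.expect (d4ShiftSet g 0 Λ') (fermionEmbed (PolySite.d4Emb g 0 Λ') Xw)).re := by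
  -- the averaged torus expectations of the rotated observables converge to their values in `ω`
  have hlim : Tendsto (fun j => (S.card : ℝ)⁻¹ * ∑ g ∈ S,
      (torusAvgExpect (Ls j) (d4ShiftSet g 0 Λ') (fermionEmbed (PolySite.d4Emb g 0 Λ') Xw) (ζ (Ls j))).re)
      atTop (𝓝 ((S.card : ℝ)⁻¹ * ∑ g ∈ S,
        (ω.expect (d4ShiftSet g 0 Λ') (fermionEmbed (PolySite.d4Emb g 0 Λ') Xw)).re)) := by
    refine (tendsto_finsetSum S fun g _ => ?_).const_mul _
    exact (Complex.continuous_re.tendsto _).comp (hω (d4ShiftSet g 0 Λ') _)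
  set b0 : ℝ := c - ∑ k ∈ w, ‖a k‖ with hb0
  -- the lower bounds converge
  have hbnd : Tendsto (fun j => b0 +
      ∑ σ : Fin 2, μ σ * ((star (ζ (Ls j)) ⬝ᵥ ((∑ y : FermionTorus 2 (Ls j), numberOp y σ) *ᵥ ζ (Ls j))).re /
        ((Ls j : ℕ) : ℝ) ^ 2 - ν) +
      κ * (u - (star (ζ (Ls j)) ⬝ᵥ (hubbardTorusTT' (Ls j) t t' U *ᵥ ζ (Ls j))).re / ((Ls j : ℕ) : ℝ) ^ 2))
      atTop (𝓝 (b0 + ∑ σ : Fin 2, μ σ * (n / 2 - ν) + κ * (u - e))) := by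
    refine (tendsto_const_nhds.add (tendsto_finsetSum _ fun σ _ => ((hN σ).sub_const ν).const_mul _)).add
      ((tendsto_const_nhds.sub hE).const_mul κ)
  -- the finite-torus inequality holds for all large `j`
  have hev' : ∀ᶠ j in atTop, b0 +
      ∑ σ : Fin 2, μ σ * ((star (ζ (Ls j)) ⬝ᵥ ((∑ y : FermionTorus 2 (Ls j), numberOp y σ) *ᵥ ζ (Ls j))).re /
        ((Ls j : ℕ) : ℝ) ^ 2 - ν) +
      κ * (u - (star (ζ (Ls j)) ⬝ᵥ (hubbardTorusTT' (Ls j) t t' U *ᵥ ζ (Ls j))).re / ((Ls j : ℕ) : ℝ) ^ 2) ≤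
      (S.card : ℝ)⁻¹ * ∑ g ∈ S,
        (torusAvgExpect (Ls j) (d4ShiftSet g 0 Λ') (fermionEmbed (PolySite.d4Emb g 0 Λ') Xw) (ζ (Ls j))).re := by
    filter_upwards [eventually_injOn_proj_of_tendsto Λ' hLs, hLs.eventually_ge_atTop 3]
      with j hInj' hL3
    haveI : NeZero (Ls j) := ⟨by omega⟩
    have h := re_orbitState_ge_of_window_variational_certificate_d4_TT'_ineq t t' U hL3 hΛ h0 hz hInj'
      h1 hmul (hζ1 j) Xw κ u μ ν hΛm O tt γ hγS wv hsh Y ah dc V w a word hcert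
    rw [re_orbitState_spaceGroupUnitary_fermionEmbed_toTorusEmb S hInj'] at h
    simp_rw [torusAvgExpect_eq]
    exact h
  have hle := le_of_tendsto_of_tendsto hbnd hlim hev'
  have hslack : 0 ≤ κ * (u - e) := mul_nonneg hκ (sub_nonneg.2 hu)
  have hs : ∑ σ : Fin 2, μ σ * (n / 2 - ν) = (∑ σ : Fin 2, μ σ) * (n / 2 - ν) := by rw [Finset.sum_mul]
  linarith

end Limit

end Literature.MathematicalPhysics.QuantumLattice

end
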